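import Mathlib
import HarnessLib
import HarnessLib.Audit
import Summits.AtomisticToContinuum.Statement
import Literature.MathematicalPhysics.KineticTheory.LangevinSemigroup
import Literature.MathematicalPhysics.KineticTheory.HarmonicChainNESS

/-!
Route: TransferKernelTP

CLOSED (retired) 2026-08-15T13:47:21Z by operator:999:1257524 — reason: not-a-thesis: assembly does not conclude the sub-problem Statement — note: D-0027 §2.1 audit (human 2026-08-15: routes that do not decide the summit are removed): the assembly concludes `Literature.MathematicalPhysics.KineticTheory.HeatConduction.FouriersLaw`, not the sub-problem statement; a NEW conforming route may be opened from the same idea (generated `closes : … → _r. The file is kept as the record of this route; refuted decls are indexed as negative knowledge (`ledger negatives`).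

# Route TransferKernelTP — Sign-regularity of the contact-to-site transfer kernel — passive (TP1)
and monotone (TP2) response profiles close the BV crux of the local-Ohm line

X_TP (TRANSFER-KERNEL SIGN-REGULARITY LINE; realises idea card
transfer-kernel-total-positivity-profile). Fix pinnedChain ω₂ lam β γ (all four > 0), T > 0,
weak-NESS uniqueness, the BLR protocol (T_L, T_R) = (T + δ/2, T − δ/2) with δ → 0 at fixed N first.
Write D_N = lim totalCurrent(μ_N)/δ (clause (ii) of FouriersLawFor), g_N = D_N/(N−1), and θ_N(i) =
lim (μ_{N,δ}(p_i²) − μ_{N,0}(p_i²))/δ for the antisymmetric kinetic-temperature RESPONSE PROFILE.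
Exact finite-N identities (support items): θ_N(i) = (γ/2T²) ∫₀^∞ ∫ (p_0² − p_{N−1}²) · P_t(p_i²)
dμ_T dt — the profile is a COLUMN of the kinetic-energy transfer kernel K_N(y,i) = ∫₀^∞
Cov_T(p_y²(0), p_i²(t)) dt (KernelIdentity) — and g_N = γ(1/2 − θ_N(0)) = γ(θ_N(N−1) + 1/2) =
(γ²/T²) K_N(0, N−1) — the conductance is its CORNER (ContactIdentity). It suffices to show X_TP =
(P) ∧ (M) ∧ [shared] where
 (P) Passivity (crux, rank 4; TP₁ = thermal passivity / maximum principle): |θ_N(i)| ≤ 1/2 for every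
N and site — heating a contact cools no site, the response profile stays between the bath responses;
 (M) MonotoneProfile (crux, rank 3; TP₂ = variation diminishing): θ_N is non-increasing from the hot
to the cold side on the bulk window ℓ ≤ i ≤ N−1−ℓ with ℓ independent of N;
 [shared with route LocalOhmRigidity, same decls] LocalOhm (crux rank 2, stmt-2738: |g_N| ≤ C
Σ_{|i−x|≤ℓ} |θ_N(i+1) − θ_N(i)| at bulk bonds), BoundedResponseConverges (crux rank 5, stmt-2741:
import slot 'bounded ⇒ converges to a positive limit'), NessUnique (0741), FiniteResponseOfUnique
(0717), FiniteResponseProfile (2742).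
(P) ∧ (M) give BVProfile (stmt-2740, crux 4 of LocalOhmRigidity) by a finite sum with C_BV = 2ℓ + 1
(support TPGlue); LocalOhm × BV gives HasBoundedResponse (their BoundedResponseGlue);
BoundedResponseConverges and clause (i) (PROVED fact
CuneoEckmannHairerReyBellet2018_pinnedChain_holds + NessUnique) give FouriersLaw.
Lean: `NessUnique ∧ FiniteResponseOfUnique ∧ FiniteResponseProfile ∧ LocalOhm ∧ MonotoneProfile ∧
Passivity ∧ BoundedResponseConverges`

## Assembly
Pure bookkeeping once the items hold: TPGlue turns Passivity + MonotoneProfile into BVProfile (C_BV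
= 2ℓ+1); the host route's finite-sum glue (LocalOhmRigidity.BoundedResponseGlue, stmt-2745: LocalOhm
summed over the N−2b−1 bulk bonds, each bond in ≤ 2ℓ+1 windows, against BV) gives HasBoundedResponse
(pinnedChain …) along the canonical family, i.e. BddAbove (range |D_N|); BoundedResponseConverges
gives D_N(T) → k(T) > 0; κ T := k(T) (T > 0, else 1); clause (i) from the PROVED fact
Literature.MathematicalPhysics.KineticTheory.HeatConduction.pinnedChain_exists_isSteadyState
(LangevinChainNESSHolds.lean, all N) + NessUnique; any other steady-state family has the same
difference quotients for |δ| < 2T (Filter.Tendsto.congr', as in hasBoundedResponse_iff_of_unique).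
Provers: import Literature.Barriers.AtomisticToContinuum.FixedLengthNoConductivityControl and
Literature.MathematicalPhysics.KineticTheory.LangevinChainNESSHolds; the host's planner verified
`assembly_of_glue` rc 0 for the same frame with BVProfile as hypothesis, so Assembly = TPGlue + that
proof.

Rationale: WHY THIS LINE. One kernel carries both the profile and the current: by the noise-amplitude (Novikov
/ open-system Green–Kubo) identity ∂⟨p_i²⟩/∂T_b = (γ/T²)∫₀^∞Cov(p_b²(0),p_i²(t))dt
(KunduDharNarayan2009; ReyBellet2003 Rem 4.4; multi-terminal harmonic form DharRoy2006) and the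
exact sum rule ∂_{T_L} + ∂_{T_R} = d/dT (equipartition), the linear-response temperature profile is
a column x ↦ K_N(N−1,x) of the contact-to-site transfer matrix ('escape through the far bath'), its
corner is the conductance, and Fourier's law becomes a SHAPE statement about one function. The
engine imported from another area is Karlin's sign-regularity of one-dimensional transfer kernels:
TP₁ = entrywise positivity = passivity (0 ≤ ∂⟨p_i²⟩/∂T_b ≤ 1), TP₂ of the N×2 matrix [K(0,·),
K(N−1,·)] = (by the sum rule) monotone column = monotone profile, and more generally variation
diminishing ⇒ BV — the classical reason absorption probabilities and Green's columns of diffusions /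
birth–death chains are monotone (Karlin1964 'total positivity, absorption probabilities';
KarlinMcgregor1959, KarlinMcgregor1960; GantmacherKrein2002 oscillation matrices for the Jacobi
force matrix at the harmonic corner), robust to inhomogeneity and boundary conditions and needing no
relaxation rate, no translation invariance and no identification of κ. What the line does that
existing routes do not: LocalOhmRigidity (opened today) files BVProfile with 'maximum-principle
structure unknown' and no engine; FeketeResistance/SuperadditiveJunction never touch the profile;
FourierGreenKubo needs infinite-volume correlation decay; the negatives index is empty. Planner
check this session (pure-python Lyapunov solve, N ≤ 11, eleven (ω₂, γ) pairs): for the conjunct's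
FREE-END pinned harmonic chain the response profile is monotone AND passive (e.g. θ = +0.375,
+0.031, +0.0078, +0.0018, 0, … for ω₂ = γ = 1), while the celebrated Rieder–Lebowitz–Lieb dip
appears only with RLL's wall springs — so both sign statements hold (numerically) at the integrable
corner of THIS family and every anharmonic input sits in the shared LocalOhm, false there (flat
bulk, O(1) current: HarmonicChainBallisticFlux).

RANKED CRUXES. #2 LocalOhm (crux) — [shared verbatim with route LocalOhmRigidity,
stmt-AtomisticToContinuum-2738; card item 4 'CornerVersusSlope' in its robust two-sided windowed
form] No current without a local kinetic-temperature gradient, uniformly in N: ∃ C, ℓ, b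
(parameters, T; not N) such that along the unique steady-state family, for every N, response
coefficient d = D_N and response profile θ, at every bulk bond x (b ≤ x ≤ N−b−2): |d|/(N−1) ≤ C
Σ_{bonds (i,i+1), |i−x|≤ℓ} |θ(i+1) − θ(i)|. In kernel language: the corner K_N(0,N−1) is at most C ×
the windowed variation of the column. Engines: comparison of K_N with the Green's function of an
absorbed nearest-neighbour (birth–death) chain with N-uniformly elliptic rates (discrete Harnack),
or the compactness + odd-sector rigidity of the host route. [difficulty: open-problem] (why it might
fail: It is the local Fourier inequality itself: no interior a-priori estimate for a pure-transport
bulk is known (BLR2000 §7), window limits may lose locality, and exactly flat bulk windows at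
infinitely many N (ballistic channel, hidden conserved charge) falsify it.)
[BonettoLebowitzReyBellet2000, Bernardin2014, KunduDharNarayan2009, Karlin1964, LepriLiviPoliti2003,
Dhar2008]
#3 MonotoneProfile (crux) — [card item 3, SignRegularity₂ / TP₂] There is ℓ (parameters, T; not N)
such that for every N and every response profile θ_N (all difference quotients converging), θ_N(j) ≤
θ_N(i) whenever ℓ ≤ i ≤ j ≤ N−1−ℓ: the linear-response kinetic temperature is non-increasing from
the hot to the cold side outside boundary layers of N-independent width. Equivalent kernel form: the
far-bath column i ↦ K_N(N−1, i) ('fraction of a kinetic-energy fluctuation at i that leaves through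
the far bath') is non-decreasing on the bulk window — gambler's-ruin monotonicity, the TP₂ minor
condition of [K(0,·), K(N−1,·)] given the sum rule. With Passivity it yields BVProfile with C_BV =
2ℓ + 1 (TPGlue). [difficulty: L] (why it might fail: A pointwise sign with N-uniform ℓ needs
boundary layers free of lattice-scale oscillation; residual phonon-interference structure of width ~
mean free path ~ (lam·T)⁻² could reverse single decrements where the slope is only O(1/N); no
comparison principle is known (global flux sign only, EPR1999b).) [Karlin1964, KarlinMcgregor1959,
GantmacherKrein2002, RiederLebowitzLieb1967, Nakazawa1970, EckmannPilletReyBellet1999b,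
AokiKusnezov2001, Dhar2008]
#4 Passivity (crux) — [card item 2, TP₁ / thermal passivity] For every N, site i and every limit t
of the profile difference quotient at i: |t| ≤ 1/2 — the antisymmetric response profile lies between
the bath responses ±1/2; equivalently (sum rule) 0 ≤ ∂⟨p_i²⟩/∂T_b ≤ 1 for each bath b, i.e. the
contact rows of the transfer kernel are entrywise non-negative, (γ/T²)K_N(b, i) ∈ [0, 1]. True at
the harmonic corner (Isserlis: Cov(p_b², p_i²(t)) = 2Cov(p_b, p_i(t))² ≥ 0; support
HarmonicPassivity); attack for lam, β > 0: cumulant split K = 2∫R² + ∫κ₄ (small-anharmonicity and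
high-T regimes first), second-order Malliavin/curvature expansion, log-concavity of the Gibbs state.
[difficulty: L] (why it might fail: Open even with self-consistent bulk noise (BLLO2009,
arXiv:0809.0953 p.6: 'we expect, but are not able to prove … T_x ∈ [T_R,T_L]'); the time-integrated
connected 4-point part may out-cancel 2∫R² at intermediate anharmonicity, half a local period away.)
[BonettoLebowitzLukkarinenOlla2009, BonettoLebowitzLukkarinen2004, DharRoy2006,
KunduDharNarayan2009, ReyBellet2003, RiederLebowitzLieb1967]
#5 BoundedResponseConverges (crux) — [shared verbatim with route LocalOhmRigidity,
stmt-AtomisticToContinuum-2741; import slot, NOT this route's mechanism] Under weak-NESS uniqueness,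
along any steady-state family, for T > 0: if the clause-(ii) response coefficients D_N exist for all
N and (|D_N|) is bounded then D_N → k for some k > 0 — 'FouriersLawFor minus HasBoundedResponse',
expected from route FeketeResistance (quasi-subadditive resistance + Fekete + PositiveConductance)
or from FourierGreenKubo's ThermodynamicLimit. [difficulty: open-problem] (why it might fail: D_N
may oscillate in N (no monotonicity/subadditivity in the length is proved; size resonances at low T
where the mean free path exceeds N) or tend to 0 (no N-uniform lower bound on the conductance beyond
μ(Φ) > 0 at fixed N).) [BonettoLebowitzReyBellet2000, EckmannPilletReyBellet1999b,
LepriLiviPoliti2003]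
#9 NessUnique (support) — [shared, stmt-AtomisticToContinuum-0741] uniqueness of the weak steady
state (IsSteadyState class) of pinnedChain for all N, T_L, T_R > 0; with the PROVED existence fact
it gives clause (i) and makes the steady-state family canonical. [difficulty: M]
[CuneoEckmannHairerReyBellet2018, Carmona2007]
#9 FiniteResponseOfUnique (support) — [shared, stmt-AtomisticToContinuum-0717] under uniqueness, the
finite-N response limits D_N(T) of clause (ii) exist (Hairer–Majda differentiability at
equilibrium). [difficulty: M] [HairerMajda2009, ReyBellet2003]
#9 FiniteResponseProfile (support) — [shared, stmt-AtomisticToContinuum-2742] under uniqueness, the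
profile difference quotients (μ_{N,δ}(p_i²) − μ_{N,0}(p_i²))/δ have limits θ_N(i) for every N and
site i (same differentiability, observable p_i²); needed to instantiate θ_N. [difficulty: M]
[HairerMajda2009, ReyBellet2003, CuneoEckmannHairerReyBellet2018]
#9 BVProfile (support) — [shared, stmt-AtomisticToContinuum-2740 — crux 4 of route LocalOhmRigidity;
in THIS route it is the DELIVERABLE of the sign-regularity engine, closed by TPGlue from Passivity +
MonotoneProfile with C = 2ℓ + 1] sup over N and response profiles of Σ_i |θ_N(i+1) − θ_N(i)| ≤ C.
[difficulty: L] [RiederLebowitzLieb1967, Nakazawa1970, Dhar2008]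
#9 TPGlue (support) — [support, provable-now; finite sums] Passivity → MonotoneProfile → BVProfile:
given ℓ from MonotoneProfile, for any N and profile θ with all limits, the bonds inside the window
[ℓ, N−1−ℓ] have non-negative decrements telescoping to θ(ℓ') − θ(N−1−ℓ') ≤ 1 (Passivity), and the ≤
2ℓ boundary bonds contribute ≤ 1 each (Passivity), so TV ≤ 2ℓ + 1. Planner check: the quantifier
plumbing `tpGlue` elaborates rc 0 in the folder (GlueCheck.lean) from the pure finite-sum lemma
tv_le (left to the prover, ~80 lines: reindex the double indicator sum over bonds,
Finset.sum_range_sub telescoping). [difficulty: provable-now] [Karlin1968, RiederLebowitzLieb1967]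
#9 ContactIdentity (support) — [support, theorem-grade at fixed N; 'conductance = corner'] under
uniqueness, for N ≥ 2, if θ₀, θ₁ are the profile limits at the contact sites 0 and N−1 and d = D_N,
then d = γ(N−1)(1/2 − θ₀) = γ(N−1)(θ₁ + 1/2). Content: stationarity applied to the contact energies
h_0 = p_0²/2 + U(q_0) + ½V(q_1−q_0) gives ⟨j_0⟩ = γ(T_L − ⟨p_0²⟩) (and the mirror identity at N−1),
all bond currents agree, and μ_{N,T,T} = Gibbs (uniqueness + pinnedChain_isSteadyState_gibbsMeasure)
gives ⟨p_0²⟩ = T at δ = 0; needs the weak Fokker–Planck identity for polynomially growing test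
functions, available from the exponential moments of the PROVED fact
CuneoEckmannHairerReyBellet2018_pinnedChain_holds by a cutoff argument. Planner check: verified to
1e−12 on the harmonic chain (Lyapunov solve, N ≤ 11). It fixes every sign convention of the route
(θ_N(0) < 1/2 ⟺ D_N > 0) and is the finite-N form of the escape-deficit/two-terminal corner
formulas. [difficulty: M] [BonettoLebowitzReyBellet2000, KunduDharNarayan2009, LepriLiviPoliti2003,
AokiKusnezov2001]
#9 KernelIdentity (support) — [support, theorem-grade at fixed N; 'profile = column of the transfer
kernel'] under uniqueness, for every N ≥ 1 there is a Langevin semigroup S of the chain at equal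
temperatures T (interface LangevinChainSemigroup; the transition semigroup of the SDE is such an S)
leaving μ_{N,T,T} invariant, such that for every site i the function t ↦ ∫ (p_0² −
p_{N−1}²)·S_t(p_i²) dμ_{N,T,T} is integrable on (0,∞) and θ_N(i) = (γ/2T²)∫₀^∞ ∫ (p_0² − p_{N−1}²)
S_t(p_i²) dμ_{N,T,T} dt (the antisymmetric combination needs no mean subtraction). This is the
noise-amplitude linear-response formula ∂⟨F⟩/∂T_b = γ∫₀^∞⟨∂²_{p_b} S_t F⟩ dt followed by Gaussian
integration by parts in p_b under the Gibbs state (KunduDharNarayan2009 open-system Green–Kubo;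
ReyBellet2003 Rem 4.4 (56); fixed-N exponential mixing CEHR2018 (2.5) for integrability). Checks: N
= 1 gives θ = 0; free OU site (γ/T²)∫Cov(p²,p²(t)) = 1/2. It is the object on which the
sign-regularity engine acts (K_N(y,i) := ∫₀^∞Cov_T(p_y², p_i²(t))dt; TP₁ = Passivity, TP₂ =
MonotoneProfile). [difficulty: M] [KunduDharNarayan2009, ReyBellet2003,
CuneoEckmannHairerReyBellet2018, DharRoy2006]
#9 HarmonicPassivity (support) — [support, calibration at the integrable corner; provable from the
in-tree Gaussian NESS] for the free-end pinned harmonic chain pinnedChain ω₂ 0 0 γ (ω₂, γ > 0) and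
its Gaussian steady state harmonicNESS ω₂ γ N T_L T_R (T_L, T_R > 0): every kinetic temperature ∫
p_i² lies in [min(T_L,T_R), max(T_L,T_R)] — Passivity (TP₁) at lam = β = 0. Proof sketch:
chainCov_eq_add (linearity in the temperatures) + chainCov_self (equipartition) + positive
SEMI-definiteness of chainCov ω₂ γ N 1 0 (limit ε → 0 of chainCov_posDef at (1, ε), affine in ε)
give ⟨p_i²⟩ = T_L a_i + T_R b_i with a_i, b_i ≥ 0, a_i + b_i = 1. (Monotonicity at the corner is
observed numerically for N ≤ 11 but deliberately NOT filed.) [difficulty: M]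
[RiederLebowitzLieb1967, Nakazawa1970, BonettoLebowitzLukkarinen2004, DharRoy2006, Dhar2008]

TWO-LAYER PLAN. Foreseen glued splits (nothing filed now; k ≤ 3, depth 1): Passivity ⇐
ContactRowsNonneg (K_N(b,i) ≥ 0 for the two contact rows b ∈ {0, N−1}, via the cumulant split 2∫R² +
∫κ₄ ≥ 0) → KernelIdentity → Passivity (k = 2); MonotoneProfile ⇐ JacobiComparison (the far-bath
column solves a three-term recursion with N-uniformly positive coefficients up to a summable defect
— the birth–death / oscillation-matrix structure, GantmacherKrein2002, Karlin1964) →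
DiscreteMaximumPrinciple → MonotoneProfile (k = 2); LocalOhm is split by its host route
(InteriorCompactness → OddSectorRigidityLin). If MonotoneProfile dies but BV survives, restate (M)
as 'sign-regular with ≤ r(T) reversals' (variation diminishing of order r), which still feeds TPGlue
with C_BV = 2ℓ + 1 + r.

KILL CRITERIA. (a) Equilibrium MD / certified numerics of the open anharmonic chain (pinnedChain 1 1
1 1, T ∈ {0.2, 1, 5}, N ∈ {32, 64, 128}): a NEGATIVE contact-row entry (γ/T²)K_N(0,i) < 0 at some
bulk site, stable in N, refutes Passivity — close `refuted:Passivity` unless the violation is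
confined to a boundary layer (then restate with an excluded layer, one repair only); (b) decrements
of θ_N changing sign at depth ≫ mean free path for a sequence of N refutes MonotoneProfile — pivot
to the BV/finite-reversal form (Two-layer plan) or close if TV(θ_N) itself grows; (c) LocalOhm
refuted (flat bulk windows with O(1)·N⁻¹ current at infinitely many N, or a hidden conserved charge
via Mazur) kills this route together with LocalOhmRigidity — and a conserved charge gives
¬FouriersLaw outright; (d) BVProfile or HasBoundedResponse proved elsewhere without sign input moots
cruxes 3–4 (the route then closes `superseded`); (e) refutation of NessUnique kills clause (i) of
the conjunct itself.

NOT DECOMPOSED YET. The kernel-level statements (TP₂ minors of [K(0,·),K(N−1,·)], sign-regularity of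
higher order, the cumulant split, the Jacobi/birth–death comparison) are prover technology below the
two cruxes and ride with `--supports Passivity|MonotoneProfile`; the definition of K_N as a
Literature notion (Definition requests); the T-dependence of ℓ(T), which may and will blow up as T →
0 (LowTemperatureWeakAnharmonicity); monotonicity INSIDE the boundary layers and at the harmonic
corner (observed numerically, not claimed); the engines of the shared cruxes LocalOhm (host route's
split) and BoundedResponseConverges (FeketeResistance / FourierGreenKubo).

CHEAPEST FALSIFIER. One equilibrium trajectory of the open chain at equal bath temperatures
(pinnedChain 1 1 1 1, T = 1, N = 32 and 64, both ends thermostatted): estimate the two contact rows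
i ↦ K_N(0,i), K_N(N−1,i) as plain time-integrated covariances of kinetic energies; the built-in
diagnostic (γ/T²)(K_N(0,i) + K_N(N−1,i)) = 1 must hold at every i (sum rule); the line dies if a
contact row goes negative in the bulk (Passivity) or if i ↦ K_N(N−1,i) fails to be monotone beyond a
few mean free paths with N-stable reversals (MonotoneProfile). Not run here (kit outside the
plancard budget). What WAS run this session: the harmonic corner by an exact Lyapunov solve (pure
python, N ≤ 11, (ω₂,γ) ∈
{(1,1),(0.5,0.3),(4,2),(1,5),(0.01,1),(0.05,1),(0.2,1),(0.01,0.2),(0.01,3),(2,0.5),(10,1),(0.3,0.1),(0.1,2),(0.02,1),(0.3,3)}):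
Passivity and monotonicity hold in every case, the contact identity D_N = γ(N−1)(1/2 − θ_N(0)) holds
to 1e−12, and the RLL dip reappears exactly when wall springs k′ = k are added — so the cheapest
conceivable falsifier (the integrable corner) does NOT kill (P) or (M) for this family.

NUMBERS. Harmonic corner, ω₂ = γ = 1, T_L − T_R = δ: θ_N = (+0.3750, +0.0312, +0.0078, +0.0018, 0,
−0.0018, …)·δ for N = 9 (geometric ratio ≈ 1/4, one sign per half-chain), D_9 = 1.000·δ… i.e. g_N →
c_∞ = 0.125 = γ(1/2 − 0.375) (ballistic); ω₂ = 0.01, γ = 1, N = 11: θ = +0.2605, +0.0082, +0.0060,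
+0.0039, +0.0019, 0, … (monotone, nearly linear bulk); RLL walls k′ = 1, ω₂ = 0, γ = 1: θ = +0.309,
−0.028, −0.004, −0.0006, … (one sign reversal = the classical dip). Anharmonic expectations
(LepriLiviPoliti2003 §6, AokiKusnezov2001, Dhar2008 §2.2): monotone profiles with contact jumps ∝ J,
mean free path ℓ(T) ~ (lam T)⁻² at low T (AokiLukkarinenSpohn2006), so ℓ in (M) is expected ≍ (lam
T)⁻². Items at open: 13 (4 cruxes, of which 2 shared; 8 support, of which 4 shared; 1 assembly).

DEFINITION REQUESTS. (1) `transferKernel` K_N(y,i) := ∫₀^∞ Cov_{μ_T}(p_y², S_t(p_i²)) dt over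
OscillatorChain + LangevinChainSemigroup (Literature/MathematicalPhysics/KineticTheory, next to
LangevinSemigroup.lean's KuboFormula), so that kernel-level lemmas (sum rule, symmetry K(y,i) =
K(i,y) by Θ-reversibility, positive semi-definiteness as a Gram matrix of Re(−L)⁻¹) can be filed
with `--supports`; (2) a small self-contained `Matrix.IsTP2` / sign-regularity-of-order-r predicate
(Mathlib has minors via Matrix.det and submatrix but no total positivity) under Literature/Analysis
or HarnessLib; (3) cite fact wanted: DharRoy2006 multi-terminal formula 'local temperature =
positive sum-to-one combination of bath temperatures' for harmonic networks (would make
HarmonicPassivity a corollary for general harmonic graphs). None of these blocks the items as filed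
(all items are typed over existing declarations).

Novelty: Searches (2026-08-15, this planner, on top of the card's searches and its refuter novelty audit
refuter-novelty-audit-…-4-0 which graded the CARD new-combination with prior DharRoy2006 / BLL2004 /
KDN2009 / ReyBellet2003): `lit frontier AtomisticToContinuum --since 2020` (30 rows; two 2026
preprints citing RLL, arXiv:2606.08839 and arXiv:2604.14056, neither on sign-regularity), `lit
bridges AtomisticToContinuum --cross any` (30 rows, none on profiles/TP), `lit search --hybrid
"temperature profile lies between bath temperatures monotone harmonic chain self-consistent
reservoirs proof"` (12 textbook hits, none relevant), `lit search --source crossref "total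
positivity oscillation matrix nonequilibrium steady state temperature profile oscillator chain"` (12
hits, none joining the two), `lit search --source crossref "Karlin total positivity absorption
probabilities diffusion monotone Green function birth death"` (found Karlin1964
doi:10.1090/s0002-9947-1964-0168010-2 and KarlinMcgregor1960 doi:10.1016/0022-247x(60)90020-2 — the
engine's home, no heat-conduction use), `lit galaxy search "temperature profile" --star all` and two
TP phrasings (noise / service saturated), arXiv and OpenAlex legs rate-limited this hour (recorded,
not worked around), `lit read arXiv:0809.0953` p.6 (BLLO2009: 'We expect, but are not able to prove,
that the self-consistent profiles remain uniformly bounded in N … We expect in fact that T_x ∈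
[T_R,T_L], as in the harmonic case'), `lit read arXiv:0808.3256  [refs: 10.1090/s0002-9947-1964-0168010-2, 10.1016/0022-247x(60, 10.1007/s10955-006-9235-3, 10.1007/bf02278011, 2606.08839, 2604.14056, 0809.0953, 0808.3256, doi:10.1090/s0002-9947-1964-0168010-2, doi:10.1016/0022-247x, doi:10.1007/s10955-006-9235-3, doi:10.1007/bf02278011, DharRoy2006, ReyBellet2003, Karlin1964, KarlinMcgregor1960, Dhar2008, BonettoLebowitzLukkarinen2004, BonettoLebowitzLukkarinenOlla200]

Barriers (technique_class: total-positivity sign-regularity local-ohm bv-profile): - technique_class: total-positivity sign-regularity local-ohm bv-profile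
- Literature.Barriers.AtomisticToContinuum.HasBoundedResponse: engaged, not evaded — Passivity and
MonotoneProfile are N-UNIFORM sign statements by construction (ℓ independent of N) and deliver only
BV/boundedness of the PROFILE; the current bound comes from the shared N-uniform LocalOhm; fixed-N
theory (CEHR2018, Hairer–Majda) enters only through the support items (FiniteResponse*,
ContactIdentity, KernelIdentity), never as an N-dependent constant.
- Literature.Barriers.AtomisticToContinuum.HarmonicChainBallisticFlux: consistent and used as
calibration — at lam = β = 0 Passivity holds (HarmonicPassivity, provable) and MonotoneProfile holds
numerically (planner Lyapunov check, N ≤ 11), while LocalOhm FAILS (flat bulk, g_N → c_∞ > 0,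
not_hasBoundedResponse); the route cannot prove too much because its only anharmonic input is
LocalOhm.
- Literature.Barriers.AtomisticToContinuum.BeckerMenegaki2022_gapClosing: not met — K_N is a
time-INTEGRATED covariance at fixed N (fixed-N exponential mixing only makes the integrals
converge); no relaxation rate uniform in N is used anywhere.
- Literature.Barriers.AtomisticToContinuum.LowTemperatureWeakAnharmonicity: respected — ℓ(T), C(T)
may and will blow up as T → 0 (ℓ ~ mean free path ~ (lam T)⁻²); nothing is claimed uniformly in T or
perturbatively in (lam, β); by the scaling conjugacy (fouriersLaw_iff_unit_pinning) only the
combination lam·T matters.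
- Literature.Ba

History (route lifecycle, newest last):
- 2026-08-15T13:47:21Z · CLOSED retired — not-a-thesis: assembly does not conclude the sub-problem Statement (operator:999:1257524)

sub-problem: FouriersLaw · status: closed(retired) · opened planner-plancard-AtomisticToContinuum-Fourier-6c9f62e6-0 2026-08-15T11:30:19Z · rev 1 · ledger route-AtomisticToContinuum-TransferKernelTP
GENERATED by the gate from the ledger (D-0016/17). Provers cite these decls: `theorem foo : Summit.AtomisticToContinuum.FouriersLaw.Theses.TransferKernelTP.<Decl> := …` in Summits/AtomisticToContinuum/FouriersLaw/Theorems/<Name>.lean.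
-/

namespace Summit.AtomisticToContinuum.FouriersLaw.Theses.TransferKernelTP

open scoped BigOperators Topology Manifold Classical MeasureTheory ProbabilityTheory Matrix InnerProductSpace ComplexConjugate ContinuousMap
open Filter Set Function TopologicalSpace MeasureTheory

attribute [summit_statement] _root_.FouriersLaw

/-- item stmt-AtomisticToContinuum-2738 · crux · rank 2 · closed · moot by None · by planner
why it might fail: It is the local Fourier inequality itself: no interior a-priori estimate for a pure-transport bulk is known (BLR2000 §7), window limits may lose locality, and exactly flat bulk windows at infinitely many N (ballistic channel, hidden conserved charge) falsify it.
sources: BonettoLebowitzReyBellet2000, Bernardin2014, KunduDharNarayan2009, Karlin1964, LepriLiviPoliti2003, Dhar2008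
[crux] LOCAL OHM INEQUALITY — 'no current without a local kinetic-temperature gradient', uniformly
in N. For pinnedChain ω₂ lam β γ (all > 0), T > 0, under weak-NESS uniqueness, along any
steady-state family: there are C, a window radius ℓ and an excluded boundary width b (depending on
the parameters and T, NOT on N) such that for every N, every response coefficient d = D_N =
lim_{δ→0} totalCurrent(μ_{N,T+δ/2,T−δ/2})/δ and every kinetic-temperature response profile θ(i) =
lim_{δ→0} (μ_{N,T+δ/2,T−δ/2}(p_i²) − μ_{N,T,T}(p_i²))/δ, at every bulk bond x (b ≤ x ≤ N−b−2):
|d|/(N−1) ≤ C · Σ_{bonds (i,i+1), |i−x| ≤ ℓ} |θ(i+1) − θ(i)| (d/(N−1) is the per-bond current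
response, all bond currents agreeing in a steady state). A LOCAL, N-uniform upper bound on the
conductivity; false for the harmonic chain lam = β = 0 (Rieder–Lebowitz–Lieb: flat bulk profile with
exponentially small window gradients but O(1) current), consistent with
HarmonicChainBallisticFlux.not_hasBoundedResponse; with local equilibrium it would hold with C ≈
κ(T)/(2ℓ+1). Intended proof (planned split, tenure): interior compactness of the normalised
first-order response densities f_N/g_N on bulk windows + odd-sector rigidity -/
@[route_item "route-AtomisticToContinuum-TransferKernelTP"]
def LocalOhm : Prop :=
  ∀ ω₂ lam β γ : ℝ, 0 < ω₂ → 0 < lam → 0 < β → 0 < γ → (∀ (N : ℕ) (T_L T_R : ℝ), 0 < T_L → 0 < T_R → ∀ μ ν : MeasureTheory.Measure (Literature.MathematicalPhysics.KineticTheory.HeatConduction.PhaseSpace N), (Literature.MathematicalPhysics.KineticTheory.HeatConduction.pinnedChain ω₂ lam β γ).IsSteadyState N T_L T_R μ → (Literature.MathematicalPhysics.KineticTheory.HeatConduction.pinnedChain ω₂ lam β γ).IsSteadyState N T_L T_R ν → μ = ν) → ∀ μ : (N : ℕ) → ℝ → ℝ → MeasureTheory.Measure (Literature.MathematicalPhysics.KineticTheory.HeatConduction.PhaseSpace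 N), (∀ (N : ℕ) (T_L T_R : ℝ), 0 < T_L → 0 < T_R → (Literature.MathematicalPhysics.KineticTheory.HeatConduction.pinnedChain ω₂ lam β γ).IsSteadyState N T_L T_R (μ N T_L T_R)) → ∀ T : ℝ, 0 < T → ∃ (C : ℝ) (ℓ b : ℕ), ∀ (N : ℕ) (d : ℝ) (θ : Fin N → ℝ), Filter.Tendsto (fun δ : ℝ => (Literature.MathematicalPhysics.KineticTheory.HeatConduction.pinnedChain ω₂ lam β γ).totalCurrent (μ N (T + δ / 2) (T - δ / 2)) / δ) (nhdsWithin 0 {(0 : ℝ)}ᶜ) (nhds d) → (∀ i : Fin N, Filter.Tendsto (fun δ : ℝ => ((∫ x, (x.2 i) ^ 2 ∂(μ N (T + δ / 2) (T - δ / 2))) - ∫ x, (x.2 i) ^ 2 ∂(μ N T T)) / δ) (nhdsWithin 0 {(0 : ℝ)}ᶜ) (nhds (θ i))) → ∀ x : ℕ, b ≤ x → x + b + 2 ≤ N → |d| / ((N : ℝ) - 1) ≤ C * ∑ i : Fin N, ∑ j : Fin N, (if j.val = i.val + 1 ∧ x ≤ i.val + ℓ ∧ i.val ≤ x + ℓ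 then |θ j - θ i| else 0)

/-- item stmt-AtomisticToContinuum-4237 · crux · rank 3 · closed · moot by None · by planner
why it might fail: A pointwise sign with N-uniform ℓ needs boundary layers free of lattice-scale oscillation; residual phonon-interference structure of width ~ mean free path ~ (lam·T)⁻² could reverse single decrements where the slope is only O(1/N); no comparison principle is known (global flux sign only, EPR1999b).
sources: Karlin1964, KarlinMcgregor1959, GantmacherKrein2002, RiederLebowitzLieb1967, Nakazawa1970, EckmannPilletReyBellet1999b
[crux] [card item 3, SignRegularity₂ / TP₂] There is ℓ (parameters, T; not N) such that for every N
and every response profile θ_N (all difference quotients converging), θ_N(j) ≤ θ_N(i) whenever ℓ ≤ i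
≤ j ≤ N−1−ℓ: the linear-response kinetic temperature is non-increasing from the hot to the cold side
outside boundary layers of N-independent width. Equivalent kernel form: the far-bath column i ↦
K_N(N−1, i) ('fraction of a kinetic-energy fluctuation at i that leaves through the far bath') is
non-decreasing on the bulk window — gambler's-ruin monotonicity, the TP₂ minor condition of [K(0,·),
K(N−1,·)] given the sum rule. With Passivity it yields BVProfile with C_BV = 2ℓ + 1 (TPGlue).
[difficulty: L] -/
@[route_item "route-AtomisticToContinuum-TransferKernelTP"]
def MonotoneProfile : Prop :=
  ∀ ω₂ lam β γ : ℝ, 0 < ω₂ → 0 < lam → 0 < β → 0 < γ → (∀ (N : ℕ) (T_L T_R : ℝ), 0 < T_L → 0 < T_R → ∀ μ ν : MeasureTheory.Measure (Literature.MathematicalPhysics.KineticTheory.HeatConduction.PhaseSpace N), (Literature.MathematicalPhysics.KineticTheory.HeatConduction.pinnedChain ω₂ lam β γ).IsSteadyState N T_L T_R μ → (Literature.MathematicalPhysics.KineticTheory.HeatConduction.pinnedChain ω₂ lam β γ).IsSteadyState N T_L T_R ν → μ = ν) → ∀ μ : (N : ℕ) → ℝ → ℝ → MeasureTheory.Measure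 (Literature.MathematicalPhysics.KineticTheory.HeatConduction.PhaseSpace N), (∀ (N : ℕ) (T_L T_R : ℝ), 0 < T_L → 0 < T_R → (Literature.MathematicalPhysics.KineticTheory.HeatConduction.pinnedChain ω₂ lam β γ).IsSteadyState N T_L T_R (μ N T_L T_R)) → ∀ T : ℝ, 0 < T → ∃ ℓ : ℕ, ∀ (N : ℕ) (θ : Fin N → ℝ), (∀ i : Fin N, Filter.Tendsto (fun δ : ℝ => ((∫ x, (x.2 i) ^ 2 ∂(μ N (T + δ / 2) (T - δ / 2))) - ∫ x, (x.2 i) ^ 2 ∂(μ N T T)) / δ) (nhdsWithin 0 {(0 : ℝ)}ᶜ) (nhds (θ i))) → ∀ i j : Fin N, ℓ ≤ i.val → i.val ≤ j.val → j.val + ℓ < N → θ j ≤ θ i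

/-- item stmt-AtomisticToContinuum-4238 · crux · rank 4 · closed · moot by None · by planner
why it might fail: Open even with self-consistent bulk noise (BLLO2009, arXiv:0809.0953 p.6: 'we expect, but are not able to prove … T_x ∈ [T_R,T_L]'); the time-integrated connected 4-point part may out-cancel 2∫R² at intermediate anharmonicity, half a local period away.
sources: BonettoLebowitzLukkarinenOlla2009, BonettoLebowitzLukkarinen2004, DharRoy2006, KunduDharNarayan2009, ReyBellet2003, RiederLebowitzLieb1967
[crux] [card item 2, TP₁ / thermal passivity] For every N, site i and every limit t of the profile
difference quotient at i: |t| ≤ 1/2 — the antisymmetric response profile lies between the bath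
responses ±1/2; equivalently (sum rule) 0 ≤ ∂⟨p_i²⟩/∂T_b ≤ 1 for each bath b, i.e. the contact rows
of the transfer kernel are entrywise non-negative, (γ/T²)K_N(b, i) ∈ [0, 1]. True at the harmonic
corner (Isserlis: Cov(p_b², p_i²(t)) = 2Cov(p_b, p_i(t))² ≥ 0; support HarmonicPassivity); attack
for lam, β > 0: cumulant split K = 2∫R² + ∫κ₄ (small-anharmonicity and high-T regimes first),
second-order Malliavin/curvature expansion, log-concavity of the Gibbs state. [difficulty: L] -/
@[route_item "route-AtomisticToContinuum-TransferKernelTP"]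
def Passivity : Prop :=
  ∀ ω₂ lam β γ : ℝ, 0 < ω₂ → 0 < lam → 0 < β → 0 < γ → (∀ (N : ℕ) (T_L T_R : ℝ), 0 < T_L → 0 < T_R → ∀ μ ν : MeasureTheory.Measure (Literature.MathematicalPhysics.KineticTheory.HeatConduction.PhaseSpace N), (Literature.MathematicalPhysics.KineticTheory.HeatConduction.pinnedChain ω₂ lam β γ).IsSteadyState N T_L T_R μ → (Literature.MathematicalPhysics.KineticTheory.HeatConduction.pinnedChain ω₂ lam β γ).IsSteadyState N T_L T_R ν → μ = ν) → ∀ μ : (N : ℕ) → ℝ → ℝ → MeasureTheory.Measure (Literature.MathematicalPhysics.KineticTheory.HeatConduction.PhaseSpace N), (∀ (N : ℕ) (T_L T_R : ℝ), 0 < T_L → 0 < T_R → (Literature.MathematicalPhysics.KineticTheory.HeatConduction.pinnedChain ω₂ lam β γ).IsSteadyState N T_L T_R (μ N T_L T_R)) → ∀ T : ℝ, 0 < T → ∀ (N : ℕ) (i : Fin N) (t : ℝ), Filter.Tendsto (fun δ : ℝ => ((∫ x, (x.2 i) ^ 2 ∂(μ N (T + δ / 2) (T - δ / 2))) - ∫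 x, (x.2 i) ^ 2 ∂(μ N T T)) / δ) (nhdsWithin 0 {(0 : ℝ)}ᶜ) (nhds t) → |t| ≤ 1 / 2

/-- item stmt-AtomisticToContinuum-2741 · crux · rank 5 · closed · moot by None · by planner
why it might fail: D_N may oscillate in N (no monotonicity/subadditivity in the length is proved; size resonances at low T where the mean free path exceeds N) or tend to 0 (no N-uniform lower bound on the conductance beyond μ(Φ) > 0 at fixed N).
sources: BonettoLebowitzReyBellet2000, EckmannPilletReyBellet1999b, LepriLiviPoliti2003
[crux] IMPORT SLOT — A BOUNDED RESPONSE SEQUENCE CONVERGES TO A POSITIVE LIMIT: under weak-NESS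
uniqueness, along any steady-state family, for T > 0: if the response coefficients D_N of clause
(ii) exist for all N and (|D_N|)_N is bounded, then D_N → k for some k > 0. This is 'FouriersLawFor
minus HasBoundedResponse' (a consequence of the conjunct under uniqueness, by uniqueness of limits
along 𝓝[≠]0) and is NOT this route's mechanism — it is the declared residual once HasBoundedResponse
is in hand, expected from the companion card fekete-resistance-subadditivity (quasi-subadditivity of
the resistance R_N = N/D_N + Fekete ⇒ R_N/N → ℓ = inf; boundedness ⇒ ℓ > 0; D_2 > 0 ⇒ ℓ < ∞; so D_N
→ 1/ℓ ∈ (0, ∞)) or from route FourierGreenKubo's ThermodynamicLimit (D_N → κ_GK > 0). Filed as a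
crux because it is open and load-bearing for the assembly; provers of the companion lines may close
it by citing their theorems. Sources: BonettoLebowitzReyBellet2000 §5.3 (33), §6.3;
EckmannPilletReyBellet1999b (μ(Φ) > 0 iff T_L > T_R at fixed N — no N-uniform lower bound);
LepriLiviPoliti2003 §6 (contact resistance); card
AtomisticToContinuum/FouriersLaw/fekete-resistance-subadditivity. -/
@[route_item "route-AtomisticToContinuum-TransferKernelTP"]
def BoundedResponseConverges : Prop :=
  ∀ ω₂ lam β γ : ℝ, 0 < ω₂ → 0 < lam → 0 < β → 0 < γ → (∀ (N : ℕ) (T_L T_R : ℝ), 0 < T_L → 0 < T_R → ∀ μ ν : MeasureTheory.Measure (Literature.MathematicalPhysics.KineticTheory.HeatConduction.PhaseSpace N), (Literature.MathematicalPhysics.KineticTheory.HeatConduction.pinnedChain ω₂ lam β γ).IsSteadyState N T_L T_R μ → (Literature.MathematicalPhysics.KineticTheory.HeatConduction.pinnedChain ω₂ lam β γ).IsSteadyState N T_L T_R ν → μ = ν) → ∀ μ : (N : ℕ) → ℝ → ℝ → MeasureTheory.Measure (Literature.MathematicalPhysics.KineticTheory.HeatConduction.PhaseSpace N), (∀ (N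 : ℕ) (T_L T_R : ℝ), 0 < T_L → 0 < T_R → (Literature.MathematicalPhysics.KineticTheory.HeatConduction.pinnedChain ω₂ lam β γ).IsSteadyState N T_L T_R (μ N T_L T_R)) → ∀ T : ℝ, 0 < T → ∀ D : ℕ → ℝ, (∀ N : ℕ, Filter.Tendsto (fun δ : ℝ => (Literature.MathematicalPhysics.KineticTheory.HeatConduction.pinnedChain ω₂ lam β γ).totalCurrent (μ N (T + δ / 2) (T - δ / 2)) / δ) (nhdsWithin 0 {(0 : ℝ)}ᶜ) (nhds (D N))) → BddAbove (Set.range fun N => |D N|) → ∃ k : ℝ, 0 < k ∧ Filter.Tendsto D Filter.atTop (nhds k)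

/-- item stmt-AtomisticToContinuum-2740 · support · rank 9 · closed · moot by None · by planner
sources: RiederLebowitzLieb1967, Nakazawa1970, Dhar2008
[crux] BOUNDED VARIATION OF THE KINETIC-TEMPERATURE RESPONSE PROFILE: under weak-NESS uniqueness,
along any steady-state family, for T > 0 there is C (parameters, T) with Σ_i |θ_N(i+1) − θ_N(i)| ≤ C
for every N and every response profile θ_N (defined by the same difference quotients as in LocalOhm;
vacuous where they have no limit). Prettier sufficient form: θ_N monotone for N ≥ N₀ — then TV =
θ_N(0) − θ_N(N−1) ≤ 1 by the bath identities γ(1/2 − θ_N(0)) = g_N = γ(θ_N(N−1) + 1/2) (from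
L(p_0²/2) and L(p_{N−1}²/2), exact). TRUE at the integrable corner (Rieder–Lebowitz–Lieb/Nakazawa:
flat bulk, boundary layers decaying geometrically, TV = O(1)) — all anharmonic content of the line
sits in LocalOhm. Converts local to global: summing LocalOhm over the N−2b−1 bulk bonds, each bond
lying in ≤ 2ℓ+1 windows, gives (N−2b−1)|D_N|/(N−1) ≤ C(2ℓ+1)·TV(θ_N) (support BoundedResponseGlue).
Caveat for provers: BV is model-specific among ballistic chains — the alternating-mass harmonic
chain has a period-2 bulk temperature oscillation, TV ≍ N (Kannan–Dhar–Lebowitz 2012,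
doi:10.1103/physreve.85.041118); the conjunct's equal-mass chain is flat-bulk. Sources:
RiederLebowitzLieb1967; Nakazawa1970; Eckma -/
@[route_item "route-AtomisticToContinuum-TransferKernelTP"]
def BVProfile : Prop :=
  ∀ ω₂ lam β γ : ℝ, 0 < ω₂ → 0 < lam → 0 < β → 0 < γ → (∀ (N : ℕ) (T_L T_R : ℝ), 0 < T_L → 0 < T_R → ∀ μ ν : MeasureTheory.Measure (Literature.MathematicalPhysics.KineticTheory.HeatConduction.PhaseSpace N), (Literature.MathematicalPhysics.KineticTheory.HeatConduction.pinnedChain ω₂ lam β γ).IsSteadyState N T_L T_R μ → (Literature.MathematicalPhysics.KineticTheory.HeatConduction.pinnedChain ω₂ lam β γ).IsSteadyState N T_L T_R ν → μ = ν) → ∀ μ : (N : ℕ) → ℝ → ℝ → MeasureTheory.Measure (Literature.MathematicalPhysics.KineticTheory.HeatConduction.PhaseSpace N), (∀ (N : ℕ) (T_L T_R : ℝ), 0 < T_L → 0 < T_R → (Literature.MathematicalPhysics.KineticTheory.HeatConduction.pinnedChain ω₂ lam β γ).IsSteadyState N T_L T_R (μ N T_L T_R)) → ∀ T : ℝ,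 0 < T → ∃ C : ℝ, ∀ (N : ℕ) (θ : Fin N → ℝ), (∀ i : Fin N, Filter.Tendsto (fun δ : ℝ => ((∫ x, (x.2 i) ^ 2 ∂(μ N (T + δ / 2) (T - δ / 2))) - ∫ x, (x.2 i) ^ 2 ∂(μ N T T)) / δ) (nhdsWithin 0 {(0 : ℝ)}ᶜ) (nhds (θ i))) → ∑ i : Fin N, ∑ j : Fin N, (if j.val = i.val + 1 then |θ j - θ i| else 0) ≤ C

/-- item stmt-AtomisticToContinuum-2742 · support · rank 9 · closed · moot by None · by planner
sources: HairerMajda2009, ReyBellet2003, CuneoEckmannHairerReyBellet2018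
[support] EXISTENCE OF THE KINETIC-TEMPERATURE RESPONSE PROFILE: under weak-NESS uniqueness, for
every steady-state family, T > 0, N and site i, δ ↦ (μ_{N,T+δ/2,T−δ/2}(p_i²) − μ_{N,T,T}(p_i²))/δ
has a limit θ_N(i) as δ → 0, δ ≠ 0 — the same differentiability-at-equilibrium content as
FiniteResponseOfUnique, for the polynomial observable p_i² instead of the bond currents (one
Hairer–Majda/Rey-Bellet argument proves both; p_i² is integrable under the true NESS since e^{ϑH}
is, CEHR2018 Thm 2.13(2)). Needed to instantiate θ_N in LocalOhm/BVProfile. N = 0: no sites.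
Sources: HairerMajda2009 Thm 2.3; ReyBellet2003 Rem 4.4; BonettoLebowitzReyBellet2000 §6.3 (34)
(real-analyticity in δT, EPR reservoirs). -/
@[route_item "route-AtomisticToContinuum-TransferKernelTP"]
def FiniteResponseProfile : Prop :=
  ∀ ω₂ lam β γ : ℝ, 0 < ω₂ → 0 < lam → 0 < β → 0 < γ → (∀ (N : ℕ) (T_L T_R : ℝ), 0 < T_L → 0 < T_R → ∀ μ ν : MeasureTheory.Measure (Literature.MathematicalPhysics.KineticTheory.HeatConduction.PhaseSpace N), (Literature.MathematicalPhysics.KineticTheory.HeatConduction.pinnedChain ω₂ lam β γ).IsSteadyState N T_L T_R μ → (Literature.MathematicalPhysics.KineticTheory.HeatConduction.pinnedChain ω₂ lam β γ).IsSteadyState N T_L T_R ν → μ = ν) → ∀ μ : (N : ℕ) → ℝ → ℝ → MeasureTheory.Measure (Literature.MathematicalPhysics.KineticTheory.HeatConduction.PhaseSpace N), (∀ (N : ℕ) (T_L T_R : ℝ), 0 < T_L → 0 < T_R → (Literature.MathematicalPhysics.KineticTheory.HeatConduction.pinnedChain ω₂ lam β γ).IsSteadyState N T_L T_R (μ N T_L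 T_R)) → ∀ T : ℝ, 0 < T → ∀ (N : ℕ) (i : Fin N), ∃ t : ℝ, Filter.Tendsto (fun δ : ℝ => ((∫ x, (x.2 i) ^ 2 ∂(μ N (T + δ / 2) (T - δ / 2))) - ∫ x, (x.2 i) ^ 2 ∂(μ N T T)) / δ) (nhdsWithin 0 {(0 : ℝ)}ᶜ) (nhds t)

/-- item stmt-AtomisticToContinuum-4239 · support · rank 9 · closed · moot by None · by planner
sources: Karlin1968, RiederLebowitzLieb1967
[support] [support, provable-now; finite sums] Passivity → MonotoneProfile → BVProfile: given ℓ from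
MonotoneProfile, for any N and profile θ with all limits, the bonds inside the window [ℓ, N−1−ℓ]
have non-negative decrements telescoping to θ(ℓ') − θ(N−1−ℓ') ≤ 1 (Passivity), and the ≤ 2ℓ boundary
bonds contribute ≤ 1 each (Passivity), so TV ≤ 2ℓ + 1. Planner check: the quantifier plumbing
`tpGlue` elaborates rc 0 in the folder (GlueCheck.lean) from the pure finite-sum lemma tv_le (left
to the prover, ~80 lines: reindex the double indicator sum over bonds, Finset.sum_range_sub
telescoping). [difficulty: provable-now] -/
@[route_item "route-AtomisticToContinuum-TransferKernelTP"]
def TPGlue : Prop :=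
  Passivity → MonotoneProfile → BVProfile

/-- item stmt-AtomisticToContinuum-4240 · support · rank 9 · closed · moot by None · by planner
sources: BonettoLebowitzReyBellet2000, KunduDharNarayan2009, LepriLiviPoliti2003, AokiKusnezov2001
[support] [support, theorem-grade at fixed N; 'conductance = corner'] under uniqueness, for N ≥ 2,
if θ₀, θ₁ are the profile limits at the contact sites 0 and N−1 and d = D_N, then d = γ(N−1)(1/2 −
θ₀) = γ(N−1)(θ₁ + 1/2). Content: stationarity applied to the contact energies h_0 = p_0²/2 + U(q_0)
+ ½V(q_1−q_0) gives ⟨j_0⟩ = γ(T_L − ⟨p_0²⟩) (and the mirror identity at N−1), all bond currents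
agree, and μ_{N,T,T} = Gibbs (uniqueness + pinnedChain_isSteadyState_gibbsMeasure) gives ⟨p_0²⟩ = T
at δ = 0; needs the weak Fokker–Planck identity for polynomially growing test functions, available
from the exponential moments of the PROVED fact CuneoEckmannHairerReyBellet2018_pinnedChain_holds by
a cutoff argument. Planner check: verified to 1e−12 on the harmonic chain (Lyapunov solve, N ≤ 11).
It fixes every sign convention of the route (θ_N(0) < 1/2 ⟺ D_N > 0) and is the finite-N form of the
escape-deficit/two-terminal corner formulas. [difficulty: M] -/
@[route_item "route-AtomisticToContinuum-TransferKernelTP"]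
def ContactIdentity : Prop :=
  ∀ ω₂ lam β γ : ℝ, 0 < ω₂ → 0 < lam → 0 < β → 0 < γ → (∀ (N : ℕ) (T_L T_R : ℝ), 0 < T_L → 0 < T_R → ∀ μ ν : MeasureTheory.Measure (Literature.MathematicalPhysics.KineticTheory.HeatConduction.PhaseSpace N), (Literature.MathematicalPhysics.KineticTheory.HeatConduction.pinnedChain ω₂ lam β γ).IsSteadyState N T_L T_R μ → (Literature.MathematicalPhysics.KineticTheory.HeatConduction.pinnedChain ω₂ lam β γ).IsSteadyState N T_L T_R ν → μ = ν) → ∀ μ : (N : ℕ) → ℝ → ℝ → MeasureTheory.Measure (Literature.MathematicalPhysics.KineticTheory.HeatConduction.PhaseSpace N), (∀ (N : ℕ) (T_L T_R : ℝ), 0 < T_L → 0 < T_R → (Literature.MathematicalPhysics.KineticTheory.HeatConduction.pinnedChain ω₂ lam β γ).IsSteadyState N T_L T_R (μ N T_L T_R)) → ∀ T : ℝ, 0 < T → ∀ (N : ℕ) (hN : 2 ≤ N) (θ₀ θ₁ d : ℝ), Filter.Tendsto (fun δ : ℝ => ((∫ x, (x.2 (⟨0, by omega⟩ : Fin N)) ^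 2 ∂(μ N (T + δ / 2) (T - δ / 2))) - ∫ x, (x.2 (⟨0, by omega⟩ : Fin N)) ^ 2 ∂(μ N T T)) / δ) (nhdsWithin 0 {(0 : ℝ)}ᶜ) (nhds θ₀) → Filter.Tendsto (fun δ : ℝ => ((∫ x, (x.2 (⟨N - 1, by omega⟩ : Fin N)) ^ 2 ∂(μ N (T + δ / 2) (T - δ / 2))) - ∫ x, (x.2 (⟨N - 1, by omega⟩ : Fin N)) ^ 2 ∂(μ N T T)) / δ) (nhdsWithin 0 {(0 : ℝ)}ᶜ) (nhds θ₁) → Filter.Tendsto (fun δ : ℝ => (Literature.MathematicalPhysics.KineticTheory.HeatConduction.pinnedChain ω₂ lam β γ).totalCurrent (μ N (T + δ / 2) (T - δ / 2)) / δ) (nhdsWithin 0 {(0 : ℝ)}ᶜ) (nhds d) → d = γ * ((N : ℝ) - 1) * (1 / 2 - θ₀) ∧ d = γ * ((N : ℝ) - 1) * (θ₁ + 1 / 2)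

/-- item stmt-AtomisticToContinuum-4241 · support · rank 9 · closed · moot by None · by planner
sources: KunduDharNarayan2009, ReyBellet2003, CuneoEckmannHairerReyBellet2018, DharRoy2006
[support] [support, theorem-grade at fixed N; 'profile = column of the transfer kernel'] under
uniqueness, for every N ≥ 1 there is a Langevin semigroup S of the chain at equal temperatures T
(interface LangevinChainSemigroup; the transition semigroup of the SDE is such an S) leaving
μ_{N,T,T} invariant, such that for every site i the function t ↦ ∫ (p_0² − p_{N−1}²)·S_t(p_i²)
dμ_{N,T,T} is integrable on (0,∞) and θ_N(i) = (γ/2T²)∫₀^∞ ∫ (p_0² − p_{N−1}²) S_t(p_i²) dμ_{N,T,T}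
dt (the antisymmetric combination needs no mean subtraction). This is the noise-amplitude
linear-response formula ∂⟨F⟩/∂T_b = γ∫₀^∞⟨∂²_{p_b} S_t F⟩ dt followed by Gaussian integration by
parts in p_b under the Gibbs state (KunduDharNarayan2009 open-system Green–Kubo; ReyBellet2003 Rem
4.4 (56); fixed-N exponential mixing CEHR2018 (2.5) for integrability). Checks: N = 1 gives θ = 0;
free OU site (γ/T²)∫Cov(p²,p²(t)) = 1/2. It is the object on which the sign-regularity engine acts
(K_N(y,i) := ∫₀^∞Cov_T(p_y², p_i²(t))dt; TP₁ = Passivity, TP₂ = MonotoneProfile). [difficulty: M] -/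
@[route_item "route-AtomisticToContinuum-TransferKernelTP"]
def KernelIdentity : Prop :=
  ∀ ω₂ lam β γ : ℝ, 0 < ω₂ → 0 < lam → 0 < β → 0 < γ → (∀ (N : ℕ) (T_L T_R : ℝ), 0 < T_L → 0 < T_R → ∀ μ ν : MeasureTheory.Measure (Literature.MathematicalPhysics.KineticTheory.HeatConduction.PhaseSpace N), (Literature.MathematicalPhysics.KineticTheory.HeatConduction.pinnedChain ω₂ lam β γ).IsSteadyState N T_L T_R μ → (Literature.MathematicalPhysics.KineticTheory.HeatConduction.pinnedChain ω₂ lam β γ).IsSteadyState N T_L T_R ν → μ = ν) → ∀ μ : (N : ℕ) → ℝ → ℝ → MeasureTheory.Measure (Literature.MathematicalPhysics.KineticTheory.HeatConduction.PhaseSpace N), (∀ (N : ℕ) (T_L T_R : ℝ), 0 < T_L → 0 < T_R → (Literature.MathematicalPhysics.KineticTheory.HeatConduction.pinnedChain ω₂ lam β γ).IsSteadyState N T_L T_R (μ N T_L T_R)) → ∀ T : ℝ, 0 < T → ∀ (N : ℕ) (hN : 0 < N), ∃ S : Literature.MathematicalPhysics.KineticTheory.HeatConduction.LangevinChainSemigroup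 (Literature.MathematicalPhysics.KineticTheory.HeatConduction.pinnedChain ω₂ lam β γ) N T T, S.IsInvariant (μ N T T) ∧ ∀ i : Fin N, MeasureTheory.IntegrableOn (fun t : ℝ => ∫ z, ((z.2 (⟨0, hN⟩ : Fin N)) ^ 2 - (z.2 (⟨N - 1, by omega⟩ : Fin N)) ^ 2) * S.act t.toNNReal (fun y => (y.2 i) ^ 2) z ∂(μ N T T)) (Set.Ioi 0) ∧ Filter.Tendsto (fun δ : ℝ => ((∫ x, (x.2 i) ^ 2 ∂(μ N (T + δ / 2) (T - δ / 2))) - ∫ x, (x.2 i) ^ 2 ∂(μ N T T)) / δ) (nhdsWithin 0 {(0 : ℝ)}ᶜ) (nhds (γ / (2 * T ^ 2) * ∫ t in Set.Ioi (0 : ℝ), ∫ z, ((z.2 (⟨0, hN⟩ : Fin N)) ^ 2 - (z.2 (⟨N - 1, by omega⟩ : Fin N)) ^ 2) * S.act t.toNNReal (fun y => (y.2 i) ^ 2) z ∂(μ N T T)))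

/-- item stmt-AtomisticToContinuum-4242 · support · rank 9 · closed · moot by None · by planner
sources: RiederLebowitzLieb1967, Nakazawa1970, BonettoLebowitzLukkarinen2004, DharRoy2006, Dhar2008
[support] [support, calibration at the integrable corner; provable from the in-tree Gaussian NESS]
for the free-end pinned harmonic chain pinnedChain ω₂ 0 0 γ (ω₂, γ > 0) and its Gaussian steady
state harmonicNESS ω₂ γ N T_L T_R (T_L, T_R > 0): every kinetic temperature ∫ p_i² lies in
[min(T_L,T_R), max(T_L,T_R)] — Passivity (TP₁) at lam = β = 0. Proof sketch: chainCov_eq_add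
(linearity in the temperatures) + chainCov_self (equipartition) + positive SEMI-definiteness of
chainCov ω₂ γ N 1 0 (limit ε → 0 of chainCov_posDef at (1, ε), affine in ε) give ⟨p_i²⟩ = T_L a_i +
T_R b_i with a_i, b_i ≥ 0, a_i + b_i = 1. (Monotonicity at the corner is observed numerically for N
≤ 11 but deliberately NOT filed.) [difficulty: M] -/
@[route_item "route-AtomisticToContinuum-TransferKernelTP"]
def HarmonicPassivity : Prop :=
  ∀ ω₂ γ : ℝ, 0 < ω₂ → 0 < γ → ∀ (N : ℕ) (T_L T_R : ℝ), 0 < T_L → 0 < T_R → ∀ i : Fin N, min T_L T_R ≤ ∫ x, (x.2 i) ^ 2 ∂(Literature.MathematicalPhysics.KineticTheory.HeatConduction.harmonicNESS ω₂ γ N T_L T_R) ∧ ∫ x, (x.2 i) ^ 2 ∂(Literature.MathematicalPhysics.KineticTheory.HeatConduction.harmonicNESS ω₂ γ N T_L T_R) ≤ max T_L T_R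

-- TODO item stmt-AtomisticToContinuum-4243 · assembly · rank 1 · closed · moot by None · by planner — BLOCKED: missing decl(s) FiniteResponseOfUnique, NessUnique; restate via `ledger route edit` once they land:
--   def Assembly : Prop := NessUnique → FiniteResponseOfUnique → FiniteResponseProfile → LocalOhm → MonotoneProfile → Passivity → BoundedResponseConverges → Literature.MathematicalPhysics.KineticTheory.HeatConduction.FouriersLaw

end Summit.AtomisticToContinuum.FouriersLaw.Theses.TransferKernelTP
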